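import Literature.NumberTheory.Automorphic.SmoothInductionExactProofs
import Literature.NumberTheory.Automorphic.JacquetModuleFrobeniusProofs
import HarnessLib

/-!
# Naturality of Frobenius reciprocity: `Hom_G(π, Ind_H^G σ) ≃ Hom_H(π|_H, σ)` and its normalised form
# `Hom_G(π, i_P^G σ) ≃ Hom_M(r_P^G π, σ)` commute with maps in BOTH variables

Topic `NumberTheory/Automorphic`; namespace `Representation`.  THEOREMS ONLY (no definition, no instance, no named
fact, no `sorry`); imports the tree's ★ `SmoothInductionExactProofs` (`smoothIndMap`, the functoriality of `Ind` in the
`H`-variable) and ★ `JacquetModuleFrobeniusProofs` (`normalizedJacquetHomEquiv`, `frobenius_normalizedInd_holds`).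

THE MATHEMATICS.  Frobenius reciprocity ([BernsteinZelevinsky1976, Prop. 2.28]; ★ `Representation.frobeniusEquiv`) is
evaluation at the identity, `e(T) = (v ↦ (T v)(1))`; the normalised form for a parabolic triple `t = (P, M, N)` with
`δ_P|_N = 1` ([BernsteinZelevinsky1977, Prop. 1.9 (b)]; ★ `frobenius_normalizedInd_holds`) is the composite
`E = (frobeniusEquiv hπ).trans (normalizedJacquetHomEquiv t π σ hδ)`, `E(T)([v]) = (T v)(1)` on the Jacquet module.
Both are NATURAL: (i) in the `G`-variable, `e(T ∘ f) = e(T) ∘ f|_H` and `E(T ∘ f) = E(T) ∘ r(f)` (`r(f) = ` ★ `jacquetMap t f`,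
`[v] ↦ [f v]`); (ii) in the `H`-∕`M`-variable, `e(Ind(u) ∘ T) = u ∘ e(T)` (`Ind(u) = ` ★ `smoothIndMap H u`) and
`E(S ∘ T) = u ∘ E(T)` for every `G`-map `S : i_P σ₁ → i_P σ₂` lying over an `M`-map `u` pointwise (`(S F)(x) = u (F x)`;
this covers `i_P(u)` without naming it).  «The adjunction is natural» is exactly what turns the bare existence
`Nonempty (Hom_G(π, i_P σ) ≃ₗ Hom_M(r_P π, σ))` of ★ `frobenius_normalizedInd` into a tool for chasing extensions
(e.g. «the adjoint of `T ∘ b` is `adj(T) ∘ r(b)`», «the adjoint of `q ∘ φ` is `p ∘ adj(φ)`» in the length-two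
arguments around reducible principal series, [Casselman1995, §3.2]).  Every statement below is an identity of
maps; the proofs are the unfolding lemmas ★ `frobeniusMap_apply`, ★ `toFun_frobeniusInvVec`, ★ `toFun_smoothIndMap`,
★ `normalizedJacquetLift_mk`, ★ `jacquetMap_mk`.  Naturality in the `G`-variable is stated on underlying linear maps
(`toLinearMap`), so that no «restriction of a `G`-map to `H`» constructor is needed.

* §1 smooth induction, any commutative ring `k`: `frobeniusMap_comp_toLinearMap`, `frobeniusMap_apply_comp`,
  `frobeniusMap_smoothIndMap_comp`, `frobeniusInv_comp_eq`, `smoothIndMap_comp_frobeniusInv`.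
* §2 normalised parabolic induction over `ℂ`: `frobeniusNormalized_apply_mk`, `frobeniusNormalized_comp_toLinearMap`,
  `frobeniusNormalized_comp_of_pointwise`, `frobeniusNormalized_symm_apply`, `frobeniusNormalized_symm_comp`.

## References
* [BernsteinZelevinsky1976] I. N. Bernstein, A. V. Zelevinsky, Russian Math. Surveys 31:3 (1976), Prop. 2.28 (Frobenius reciprocity).
* [BernsteinZelevinsky1977] I. N. Bernstein, A. V. Zelevinsky, Ann. Sci. ÉNS 10 (1977), §1.8–1.9, Prop. 1.9 (b) (the functors `i`, `r`; adjunction).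
* [Casselman1995] W. Casselman, *Introduction to the theory of admissible representations of p-adic reductive groups* (1995), §3.2 (Thm. 3.2.4).
-/

set_option autoImplicit false

noncomputable section

namespace Representation

open Literature.NumberTheory.Automorphic

/-! ## §1 Smooth induction: `e = frobeniusMap H σ π`, `e(T) v = (T v)(1)` -/

section Smooth

variable {k G V V' W₁ W₂ : Type*} [CommRing k] [Group G] [TopologicalSpace G] [SeparatelyContinuousMul G]
  [AddCommGroup V] [Module k V] [AddCommGroup V'] [Module k V']
  [AddCommGroup W₁] [Module k W₁] [AddCommGroup W₂] [Module k W₂]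
  (H : Subgroup G) {σ : Representation k H W₁} {σ₂ : Representation k H W₂}
  {π : Representation k G V} {π' : Representation k G V'}

/-- **Naturality of Frobenius reciprocity in the `G`-variable** (underlying linear maps): for a `G`-map `f : π′ → π` and
`T : π → Ind_H^G σ`, `e(T ∘ f) = e(T) ∘ f`. [cite: BernsteinZelevinsky1976, Proposition 2.28] -/
theorem frobeniusMap_comp_toLinearMap (f : π'.IntertwiningMap π) (T : π.IntertwiningMap (smoothIndRep H σ)) :
    (frobeniusMap H σ π' (T.comp f)).toLinearMap = (frobeniusMap H σ π T).toLinearMap ∘ₗ f.toLinearMap :=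
  rfl

/-- Pointwise form: `e(T ∘ f) v = e(T) (f v)`. [cite: BernsteinZelevinsky1976, Proposition 2.28] -/
theorem frobeniusMap_apply_comp (f : π'.IntertwiningMap π) (T : π.IntertwiningMap (smoothIndRep H σ)) (v : V') :
    frobeniusMap H σ π' (T.comp f) v = frobeniusMap H σ π T (f v) :=
  rfl

/-- **Naturality of Frobenius reciprocity in the `H`-variable**: for an `H`-map `u : σ → σ₂` and `T : π → Ind_H^G σ`,
`e(Ind(u) ∘ T) = u ∘ e(T)` (`Ind(u) = smoothIndMap H u`, `(Ind(u) F)(x) = u (F x)`). [cite: BernsteinZelevinsky1977, §1.8] -/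
theorem frobeniusMap_smoothIndMap_comp (u : σ.IntertwiningMap σ₂) (T : π.IntertwiningMap (smoothIndRep H σ)) :
    frobeniusMap H σ₂ π ((smoothIndMap H u).comp T) = u.comp (frobeniusMap H σ π T) :=
  IntertwiningMap.ext (LinearMap.ext fun _ => rfl)

/-- The inverse map is natural in the `G`-variable: `e⁻¹(φ) ∘ f` is the inverse image of `φ ∘ f` — stated as
`(e⁻¹ φ) (f v) = e′⁻¹ (φ′) v` whenever `φ′` and `φ ∘ f` agree as linear maps (so no «restriction of `f` to `H`» constructor
is needed). [cite: BernsteinZelevinsky1976, Proposition 2.28] -/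
theorem frobeniusInv_comp_eq (hπ : π.IsSmooth) (hπ' : π'.IsSmooth) (f : π'.IntertwiningMap π)
    (φ : IntertwiningMap (π.comp H.subtype) σ) (φ' : IntertwiningMap (π'.comp H.subtype) σ)
    (hφ : φ'.toLinearMap = φ.toLinearMap ∘ₗ f.toLinearMap) :
    frobeniusInv hπ' φ' = (frobeniusInv hπ φ).comp f := by
  refine IntertwiningMap.ext (LinearMap.ext fun v => SmoothInd.ext (funext fun g => ?_))
  change (frobeniusInvVec hπ' φ' v).toFun g = (frobeniusInvVec hπ φ (f v)).toFun g
  rw [toFun_frobeniusInvVec, toFun_frobeniusInvVec, ← IntertwiningMap.toLinearMap_apply _ _ φ', hφ,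
    LinearMap.comp_apply, IntertwiningMap.toLinearMap_apply, IntertwiningMap.toLinearMap_apply, f.isIntertwining]

/-- The inverse map is natural in the `H`-variable: `Ind(u) ∘ e⁻¹(φ) = e⁻¹(u ∘ φ)`. [cite: BernsteinZelevinsky1977, §1.8] -/
theorem smoothIndMap_comp_frobeniusInv (hπ : π.IsSmooth) (u : σ.IntertwiningMap σ₂)
    (φ : IntertwiningMap (π.comp H.subtype) σ) :
    (smoothIndMap H u).comp (frobeniusInv hπ φ) = frobeniusInv hπ (u.comp φ) :=
  IntertwiningMap.ext (LinearMap.ext fun _ => SmoothInd.ext (funext fun _ => rfl))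

end Smooth

/-! ## §2 Normalised parabolic induction: `E = (frobeniusEquiv hπ).trans (normalizedJacquetHomEquiv t π σ hδ)` -/

section Normalized

variable {G : Type*} [Group G] [TopologicalSpace G] [IsTopologicalGroup G]
  (t : ParabolicTriple G) [LocallyCompactSpace t.P]
  {V V' W W₂ : Type*} [AddCommGroup V] [Module ℂ V] [AddCommGroup V'] [Module ℂ V']
  [AddCommGroup W] [Module ℂ W] [AddCommGroup W₂] [Module ℂ W₂]
  {π : Representation ℂ G V} {π' : Representation ℂ G V'}
  (σ : Representation ℂ t.M W) (σ₂ : Representation ℂ t.M W₂)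

/-- **The normalised Frobenius equivalence is evaluation at `1` on the Jacquet module**: for `T : π → i_P^G σ`,
`E(T)([v]) = (T v)(1)`, `E = (frobeniusEquiv hπ).trans (normalizedJacquetHomEquiv t π σ hδ)` — the explicit witness of
★ `frobenius_normalizedInd_holds`. [cite: BernsteinZelevinsky1977, Proposition 1.9(b), p. 445] -/
theorem frobeniusNormalized_apply_mk (hπ : π.IsSmooth)
    (hδ : ∀ (n : G) (hn : n ∈ t.N), deltaChar t.P ⟨n, t.N_le hn⟩ = 1)
    (T : π.IntertwiningMap (Representation.normalizedInd t σ)) (v : V) :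
    ((frobeniusEquiv (H := t.P) (σ := Representation.twist (σ.comp t.proj) (rootDeltaChar t.P)) hπ).trans
        (normalizedJacquetHomEquiv t π σ hδ)) T (Coinvariants.mk (t.restrict π) v) = (T v).toFun 1 :=
  rfl

/-- **Naturality in the `G`-variable** (underlying linear maps on the Jacquet modules): for a `G`-map `f : π′ → π` and
`T : π → i_P^G σ`, `E′(T ∘ f) = E(T) ∘ r_P(f)` with `r_P(f) = jacquetMap t f`, `[v] ↦ [f v]` — «the adjoint of `T ∘ f` is
`adj(T) ∘ r(f)`». [cite: BernsteinZelevinsky1977, Proposition 1.9(b), p. 445] [cite: Casselman1995, §3.2] -/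
theorem frobeniusNormalized_comp_toLinearMap (hπ : π.IsSmooth) (hπ' : π'.IsSmooth)
    (hδ : ∀ (n : G) (hn : n ∈ t.N), deltaChar t.P ⟨n, t.N_le hn⟩ = 1)
    (f : π'.IntertwiningMap π) (T : π.IntertwiningMap (Representation.normalizedInd t σ)) :
    (((frobeniusEquiv (H := t.P) (σ := Representation.twist (σ.comp t.proj) (rootDeltaChar t.P)) hπ').trans
        (normalizedJacquetHomEquiv t π' σ hδ)) (T.comp f)).toLinearMap =
      (((frobeniusEquiv (H := t.P) (σ := Representation.twist (σ.comp t.proj) (rootDeltaChar t.P)) hπ).trans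
        (normalizedJacquetHomEquiv t π σ hδ)) T).toLinearMap ∘ₗ (jacquetMap t f).toLinearMap := by
  refine Coinvariants.hom_ext (LinearMap.ext fun v => ?_)
  rfl

/-- **Naturality in the `M`-variable**: for `T : π → i_P^G σ`, an `M`-map `u : σ → σ₂` and ANY `G`-map
`S : i_P^G σ → i_P^G σ₂` lying over `u` pointwise (`(S F)(x) = u (F x)` — e.g. `i_P(u)`), `E₂(S ∘ T) = u ∘ E(T)` — «the adjoint
of `S ∘ T` is `u ∘ adj(T)`». [cite: BernsteinZelevinsky1977, §1.8] [cite: Casselman1995, §3.2] -/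
theorem frobeniusNormalized_comp_of_pointwise (hπ : π.IsSmooth)
    (hδ : ∀ (n : G) (hn : n ∈ t.N), deltaChar t.P ⟨n, t.N_le hn⟩ = 1)
    (T : π.IntertwiningMap (Representation.normalizedInd t σ))
    (S : (Representation.normalizedInd t σ).IntertwiningMap (Representation.normalizedInd t σ₂))
    (u : σ.IntertwiningMap σ₂)
    (hS : ∀ (F : SmoothInd t.P (Representation.twist (σ.comp t.proj) (rootDeltaChar t.P))) (x : G),
      (S F).toFun x = u (F.toFun x)) :
    ((frobeniusEquiv (H := t.P) (σ := Representation.twist (σ₂.comp t.proj) (rootDeltaChar t.P)) hπ).trans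
        (normalizedJacquetHomEquiv t π σ₂ hδ)) (S.comp T) =
      u.comp (((frobeniusEquiv (H := t.P) (σ := Representation.twist (σ.comp t.proj) (rootDeltaChar t.P)) hπ).trans
        (normalizedJacquetHomEquiv t π σ hδ)) T) := by
  refine IntertwiningMap.ext (Coinvariants.hom_ext (LinearMap.ext fun v => ?_))
  change (S (T v)).toFun 1 = u ((T v).toFun 1)
  exact hS (T v) 1

/-- **The inverse normalised equivalence**: `E⁻¹(ψ) v = (g ↦ ψ [π g v])`, i.e. `(E⁻¹ ψ v)(g) = ψ [π g v]`.
[cite: BernsteinZelevinsky1977, Proposition 1.9(b), p. 445] -/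
theorem frobeniusNormalized_symm_apply (hπ : π.IsSmooth)
    (hδ : ∀ (n : G) (hn : n ∈ t.N), deltaChar t.P ⟨n, t.N_le hn⟩ = 1)
    (ψ : (π.normalizedJacquet t).IntertwiningMap σ) (v : V) (g : G) :
    ((((frobeniusEquiv (H := t.P) (σ := Representation.twist (σ.comp t.proj) (rootDeltaChar t.P)) hπ).trans
        (normalizedJacquetHomEquiv t π σ hδ)).symm ψ) v).toFun g = ψ (Coinvariants.mk (t.restrict π) (π g v)) :=
  rfl

/-- **Naturality of the inverse in the `G`-variable**: for `f : π′ → π`, `ψ : r_P π → σ` and any `ψ′ : r_P π′ → σ` that IS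
`ψ ∘ r_P(f)` on underlying linear maps (`r_P(f) = jacquetMap t f`; stated this way so that no «normalised `jacquetMap`»
constructor is needed — the twists `δ_P^{−1/2}` on both Jacquet modules match), `E′⁻¹(ψ′) = E⁻¹(ψ) ∘ f`.
[cite: BernsteinZelevinsky1977, Proposition 1.9(b), p. 445] [cite: Casselman1995, §3.2] -/
theorem frobeniusNormalized_symm_comp (hπ : π.IsSmooth) (hπ' : π'.IsSmooth)
    (hδ : ∀ (n : G) (hn : n ∈ t.N), deltaChar t.P ⟨n, t.N_le hn⟩ = 1)
    (f : π'.IntertwiningMap π) (ψ : (π.normalizedJacquet t).IntertwiningMap σ)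
    (ψ' : (π'.normalizedJacquet t).IntertwiningMap σ)
    (hψ : ψ'.toLinearMap = ψ.toLinearMap ∘ₗ (jacquetMap t f).toLinearMap) :
    ((frobeniusEquiv (H := t.P) (σ := Representation.twist (σ.comp t.proj) (rootDeltaChar t.P)) hπ').trans
        (normalizedJacquetHomEquiv t π' σ hδ)).symm ψ' =
      (((frobeniusEquiv (H := t.P) (σ := Representation.twist (σ.comp t.proj) (rootDeltaChar t.P)) hπ).trans
        (normalizedJacquetHomEquiv t π σ hδ)).symm ψ).comp f := by
  refine IntertwiningMap.ext (LinearMap.ext fun v => SmoothInd.ext (funext fun g => ?_))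
  change ψ' (Coinvariants.mk (t.restrict π') (π' g v)) = ψ (Coinvariants.mk (t.restrict π) (π g (f v)))
  rw [← IntertwiningMap.toLinearMap_apply _ _ ψ', hψ, LinearMap.comp_apply, IntertwiningMap.toLinearMap_apply,
    IntertwiningMap.toLinearMap_apply, jacquetMap_mk, f.isIntertwining]

end Normalized

end Representation
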